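import Literature.MathematicalPhysics.QuantumFieldTheory.Balaban1983to89.B8Thm2TorusMember
import Literature.MathematicalPhysics.QuantumFieldTheory.Balaban1983to89.B8Thm2TorusAt

/-!
# `Balaban1983to89.B8Thm2TorusBridge` — [Balaban1985RegularSpaces] THEOREM 2 (p. 83) FOR `Ω_j = T_η`: THE CURRENCY BRIDGE from the
# `zdGF3`-member form at the torus members (`B8Thm2TorusMember.thm2_torus_of_socketsE`) TOWARDS THE INTERFACE OF RECORD
# `B8Thm2TorusAt` — hypotheses (1.34)-axial ∕ (1.35) in the interface's form, conclusion with the exponent field `A` NAMED, `U₁ = U′^{u⁻¹} = e^{iηA}`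
# EVERYWHERE, (1.36)₁ pointwise, (1.37) = `C137T`, (1.38) = `IsLandau138 … univ (torusLam k)`; the remaining members in the knit's weighted-norm
# currency (sub-row «G-B8-T2S», module M4-core of `lit-balaban-p33/T2S-MAP.md`)

statement-level skeleton of published theorems with citation tags; proofs where landed; nothing here is a claim about the
Yang–Mills mass gap

T. Bałaban, *Spaces of regular gauge field configurations on a lattice and gauge fixing conditions*, Commun. Math. Phys. **99** (1985)
75–102 `[Balaban1985RegularSpaces]` ("B8"; printed page = PDF page + 74): Theorem 2 p. 83, (1.33)–(1.39) pp. 82–83, (1.19) p. 79, (1.29) p. 81,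
p. 77 (admitted case `Ω_j = T_η`).  STATUS: published, refereed.

CITATION HEADER (lean-in-tree rule).  Cell `lit-balaban`, seat `lit-balaban-p33` (gen 90), sub-row «G-B8-T2S» ([B8] §3 Theorem 2 torus supplier
for R3 `stmt-QuantumFields-19200`), module M4-core.  WHAT IS REPRODUCED: nothing new is proved about Theorem 2; the member theorem of M2 is
RE-READ in the letters of the interface `B8Thm2TorusAt`: (a) the (1.35) premise of the knit (top-lattice bonds, `≤`, `mulCfg`) from the
interface's `Cond135T` (strict); (b) the (1.34)-axial premise at EVERY truncation `m ≤ k` (`InAx L m (torusLam m)`) from the interface's single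
`InAx L k (torusLam k)` (a block of the `m`-lattice under a top site of the `m`-lattice is a block under its level-`k` ancestor — `under_add_of_under`);
(c) in the conclusion, at `Ω_j = ℤᵈ` every bond is a side of a plaquette touching `Ω_j` (`d ≥ 2`), so the knit's masked logarithm IS the logarithm
`A = (iη)⁻¹ log U₁` and `U₁ = e^{iηA}` holds at EVERY bond; (1.36)₁ pointwise; the (1.37) clause on «all top-lattice bonds» IS `C137T`; the Landau
clause IS `IsLandau138 L k η univ (torusLam k) U₀ A`.  Kind: theorems only; no `def`, no `… : Prop` fact; no existing module modified.

## WHAT IS CERTIFIED HERE (kernel; axioms `propext` ∕ `Classical.choice` ∕ `Quot.sound`)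
* §1 `h135_of_cond135T`, `inAx_torusLam_of_top`, `mlogCfg_univ` (masked log = log at `Ω_j = ℤᵈ`), `sideTouches_univ'` (private);
* §2 **`thm2T_core_of_socketsE`** — for every torus member: from (1.33) `InAk … univ U₀`, (1.34) `InAk … univ (U′U₀) ∧ InAx L k (torusLam k) U₀ (U′U₀)`,
  (1.35) `Cond135T L k U₀ U′ α₁`, `α₀ + α₁ ≤ c₁`: a unitary-valued `u` with (1.29) `Restr129 L k (torusLam k) U₀ u` and a bondwise self-adjoint `A`
  with `U′^{u⁻¹} = e^{iηA}` (`mgauge U₀ u⁻¹ U′ = cfgExp η A`), (1.36)₁ `‖A_b‖ ≤ B₁(α₀ + (11d²α₀ + α₁))(Lʲη)⁻¹` (all `j ≤ k`, all bonds), (1.37)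
  `C137T L k η α₁ U₀ A`, (1.38) `IsLandau138 L k η univ (torusLam k) U₀ A`, and — in the knit's currency — (1.36)₂ `|∇^η_{U₀}A|₍₋₂₎ ≤ B₁(…)`,
  (1.36)₃ the `β`-Hölder norm `≤ B₂(…)`, (1.39) `|D^{η*}D^ηA|₍₋₃₎, |Δ^η A|₍₋₃₎ ≤ B₁(…)`; ONE triple `B₁ B₂ c₁` for all torus members; MODULO the four
  sockets of M2 at torus members.

## HONEST SCOPE — what is NOT claimed
(i) NOT YET `Thm2TorusAt`∕`Concl2T`: the PERIODICITY of `u`, `A` for periodic data (module M1: uniqueness + shift covariance), the `G`-valuedness for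
`G ⊊ unitaryUnits` (joint J-SU), the POINTWISE STRICT forms `C136T`(2)(3)∕`C139T` of the weighted-norm members (needs the a-priori boundedness of the
weighted families, module M4-fine) and the smallness letter (`α₀ + (11d²α₀ + α₁)` here, `α₀ + α₁` with `B₁(1 + 11d²)` there) are NOT done here.
(ii) The sockets remain hypotheses at the torus members ([4] Thms 3.1–3.3 at a general background: `T2S-MAP.md` M5…).  (iii) `d ≥ 2`, `L ≥ 2`, `𝔸`
a C⋆-algebra, `U₀ U′` unitary-valued; `T_η ↦ ℤᵈ`.  Count-neutral; N05 not discharged; nothing continuum ∕ ℝ⁴ ∕ OS ∕ mass-gap ∕ Clay.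
-/

noncomputable section

open NormedSpace

namespace Literature.MathematicalPhysics.QuantumFieldTheory.Balaban1983to89.B8Thm2TorusBridge

open B7Prop2Explicit B7Prop1Local B7Eq92Concrete
open B8Ineq132 (InAk BondTouches Under covDerivFwd)
open B8Eq119TwistedAxial (Restr129 InAx)
open B8Lemma1NonAbelian (mulCfg)
open B8Ineq130 (tlo thi)
open B8Eq140Level (SideTouches sideTouches_of_bondTouches)
open B8Eq184Proof (cfgExp)
open B8Eq146AExpansion (iEta plaqCovDeriv)
open B8Eq143PlaqExpansion (pdiv)
open B7Prop4GeneralLevels (logCovIter)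
open B8Eq138LandauZd (IsLandau138 IsLandau138W logCfg covLap)
open B9Eq340HolderZd (hquot AdmPair)
open B8ScaledSupNorm (msup bondNorm)
open B8Thm4TorusAt (torusLam mem_torusLam_iff torusLam_of_ne)
open B8Thm2TorusAt (Cond135T C137T)
open B8LeafModelZd (ZdIdx)
open B8LeafModelZdSockP5uE (SockP5uE)
open B8LeafModelZdOfHFP (SockHFP₀ SockHFP)
open B8LeafModelZd3 (zdGF3 SockB9P3 mlogCfg mlogCfg_of_sideTouches)
open B8Ineq166Univ (under_add_of_under)
open B8Thm2TorusMember (TorusMember torusIdx torusLamb mem_torusLamb_iff exists_under bondTouches_torusLam_iff thm2_torus_of_socketsE)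

-- the `ℤ^d` sites of `B7Prop1Explicit` are `LSite` here (convention of `B8Thm2TorusAt`).
open B7Prop1Explicit renaming Site → LSite
open B7Prop1Explicit (e)

variable {d : ℕ}

/-! ## §1  The hypothesis-side readings and the masked logarithm at `Ω_j = ℤᵈ` -/

section Hyp

variable {𝔸 : Type} [CStarAlgebra 𝔸] [Nontrivial 𝔸]

omit [Nontrivial 𝔸] in
/-- **(1.35) of the interface gives the knit's (1.35) premise at the torus member**: the knit asks `‖(U′U₀)‾ʲ_b − Ū₀ʲ_b‖ ≤ α₁` on the bonds
`b` touching `Λ_j = torusLam k j` — none below `k`, all at `k` — and `Cond135T` is the strict bound on all top-lattice bonds.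
[cite: Balaban1985RegularSpaces, (1.35) p.82, p.77 (bond convention)] -/
theorem h135_of_cond135T {L k : ℕ} {U₀ U' : LSite d → Fin d → 𝔸ˣ} {α₁ : ℝ} (h : Cond135T L k U₀ U' α₁) :
    ∀ j, j ≤ k → ∀ (z : LSite d) (μ : Fin d), BondTouches (torusLam (d := d) k j) z μ →
      (∀ x, InBox (loK L j z) (bondHiK L j z μ) x → x ∈ (Set.univ : Set (LSite d))) →
      ‖(avgIter L (mulCfg U' U₀) j z μ : 𝔸) - (avgIter L U₀ j z μ : 𝔸)‖ ≤ α₁ := by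
  intro j _ z μ hb _
  have hj : j = k := (bondTouches_torusLam_iff k j z μ).1 hb
  subst hj
  have hm : mulCfg U' U₀ = U' * U₀ := rfl
  rw [hm]
  exact (h z μ).le

omit [Nontrivial 𝔸] in
/-- **(1.34)-axial at the top truncation gives it at every truncation `m ≤ k`** for the torus constraint sequences: (1.19) below a site of
`Λ_m = T^{(m)}` at the levels `n < m` is (1.19) below its level-`k` ancestor in `Λ_k = T^{(k)}` (blocks compose, `under_add_of_under`).
[cite: Balaban1985RegularSpaces, (1.19) p.79, (1.34) p.82, (1.28) p.81] -/
theorem inAx_torusLam_of_top {L k : ℕ} (hL : 1 ≤ L) {U₀ W : LSite d → Fin d → 𝔸ˣ} (h : InAx L k (torusLam k) U₀ W) :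
    ∀ m, m ≤ k → InAx L m (torusLam m) U₀ W := by
  intro m hm j hj1 hjm xj hxj n hn z hz r
  have hj : j = m := (mem_torusLam_iff m j xj).1 hxj
  subst hj
  obtain ⟨y, hy⟩ := exists_under hL (k - j) xj
  have hz' : Under L (k - (n + 1)) y z := by
    have h' := under_add_of_under hy hz
    have e : k - j + (j - (n + 1)) = k - (n + 1) := by omega
    rwa [e] at h'
  exact h k (le_trans hj1 hm) le_rfl y ((mem_torusLam_iff k k y).2 rfl) n (by omega) z hz' r

omit [CStarAlgebra 𝔸] [Nontrivial 𝔸] in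
/-- At `Ω = ℤᵈ` every bond is a side of a plaquette touching `Ω` (`d ≥ 2`; the statement of `B8Prop7GlevZd3.sideTouches_of_univ`, re-proved to
keep the import cone small). [cite: Balaban1985RegularSpaces, p.77 (plaquette ∕ bond conventions)] -/
private theorem sideTouches_univ' (hd2 : 2 ≤ d) (y : LSite d) (τ : Fin d) : SideTouches (Set.univ : Set (LSite d)) y τ := by
  haveI : Nontrivial (Fin d) := Fin.nontrivial_iff_two_le.mpr hd2
  obtain ⟨κ, hκ⟩ := exists_ne τ
  exact sideTouches_of_bondTouches hκ (Or.inl (Set.mem_univ y))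

omit [Nontrivial 𝔸] in
/-- **At `Ω_j = ℤᵈ` the knit's masked logarithm is the logarithm**: `mlogCfg k η {ℤᵈ} U₁ = (iη)⁻¹ log U₁` at every bond.
[cite: Balaban1985RegularSpaces, (1.36) p.82 («U₁ = exp iηA»)] -/
theorem mlogCfg_univ (hd2 : 2 ≤ d) (k : ℕ) (η : ℝ) (U₁ : LSite d → Fin d → 𝔸ˣ) :
    mlogCfg k η (fun _ => (Set.univ : Set (LSite d))) U₁ = logCfg η U₁ := by
  funext y τ
  exact mlogCfg_of_sideTouches η U₁ (Nat.zero_le k) (sideTouches_univ' hd2 y τ)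

end Hyp

section Readers

/-- Field readers of the torus member (by `rfl`). [folklore] -/
private theorem tI_eta {L : ℕ} (hL : 1 ≤ L) (t : TorusMember) : (torusIdx (d := d) hL t).η = t.η := rfl
/-- Field readers of the torus member (by `rfl`). [folklore] -/
private theorem tI_k {L : ℕ} (hL : 1 ≤ L) (t : TorusMember) : (torusIdx (d := d) hL t).k = t.k := rfl
/-- Field readers of the torus member (by `rfl`). [folklore] -/
private theorem tI_Ω {L : ℕ} (hL : 1 ≤ L) (t : TorusMember) : (torusIdx (d := d) hL t).Ω = fun _ => Set.univ := rfl
/-- Field readers of the torus member (by `rfl`). [folklore] -/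
private theorem tI_Λs {L : ℕ} (hL : 1 ≤ L) (t : TorusMember) : (torusIdx (d := d) hL t).Λs = fun m => torusLam m := rfl
/-- Field readers of the torus member (by `rfl`). [folklore] -/
private theorem tI_Λb {L : ℕ} (hL : 1 ≤ L) (t : TorusMember) : (torusIdx (d := d) hL t).Λb = fun m => torusLamb m := rfl

end Readers

/-! ## §2  Theorem 2 at the torus members in the letters of the interface (core) -/

section Core

variable {𝔸 : Type} [CStarAlgebra 𝔸] [Nontrivial 𝔸]

/-- **THEOREM 2 (p. 83) FOR `Ω_j = T_η`, CORE BRIDGE TO THE INTERFACE `B8Thm2TorusAt`** (existence half; see the module docstring): for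
`d, L ≥ 2`, `B₀ > 0` with `2 ≤ 5dLB₀`, `B₀′, B₀β > 0`, provider thresholds, Hölder data `β, len`, ONE triple `B₁, B₂, c₁ > 0` such that at every
torus member (`η > 0`, `k ≥ 1`), for `α₀, α₁ > 0` with `α₀ + α₁ ≤ c₁`, unitary-valued `U₀`, `U′` with (1.33) `U₀ ∈ 𝔄_k({T_η}, α₀)`, (1.34)
`U′U₀ ∈ 𝔄_k({T_η}, α₀) ∩ Ax_k(𝔅_k, U₀)` (`𝔅_k` from `torusLam k`), (1.35) `Cond135T`: there are a unitary-valued gauge transformation `u` with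
(1.29) and a bondwise self-adjoint `A` with `U′^{u⁻¹} = e^{iηA}` everywhere, (1.36)₁ pointwise at every level, (1.37) `C137T`, (1.38)
`IsLandau138 … univ (torusLam k)`, and (1.36)₂,₃ ∕ (1.39) in the weighted-norm currency — MODULO the four knit sockets at torus members
(`B8Thm2TorusMember.thm2_torus_of_socketsE`). [cite: Balaban1985RegularSpaces, Thm 2 p.83, (1.33)–(1.39) pp.82–83, (1.29) p.81, p.77 («Ω_j = T_η»)] -/
theorem thm2T_core_of_socketsE (hd2 : 2 ≤ d) {L : ℕ} (hL : 2 ≤ L) {β : ℝ} {len : LSite d → ℝ}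
    {B₀ B₀' B₀β cu cF₀ cF cu' cB9 : ℝ} (hB₀ : 0 < B₀) (hB₀' : 0 < B₀') (hB₀β : 0 < B₀β) (hB : 2 ≤ 5 * (d : ℝ) * L * B₀)
    (hcu : 0 < cu) (hcF₀ : 0 < cF₀) (hcF : 0 < cF) (hcu' : 0 < cu') (hcB9 : 0 < cB9)
    (SHFP₀ : ∀ t : TorusMember, SockHFP₀ (𝔸 := 𝔸) L B₀ B₀' cF₀ (torusIdx (d := d) (le_trans one_le_two hL) t).η
      (torusIdx (d := d) (le_trans one_le_two hL) t).k (torusIdx (d := d) (le_trans one_le_two hL) t).Ω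
      (torusIdx (d := d) (le_trans one_le_two hL) t).Λs)
    (SHFP : ∀ t : TorusMember, SockHFP (𝔸 := 𝔸) L B₀ B₀' cF (torusIdx (d := d) (le_trans one_le_two hL) t).η
      (torusIdx (d := d) (le_trans one_le_two hL) t).k (torusIdx (d := d) (le_trans one_le_two hL) t).Ω
      (torusIdx (d := d) (le_trans one_le_two hL) t).Λs)
    (SP5u : ∀ t : TorusMember, SockP5uE (𝔸 := 𝔸) L B₀ cu' cu (torusIdx (d := d) (le_trans one_le_two hL) t).η
      (torusIdx (d := d) (le_trans one_le_two hL) t).k (torusIdx (d := d) (le_trans one_le_two hL) t).Ω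
      (torusIdx (d := d) (le_trans one_le_two hL) t).Λs)
    (SB9all : ∀ t : TorusMember, ∀ m, m ≤ (torusIdx (d := d) (le_trans one_le_two hL) t).k →
      SockB9P3 (𝔸 := 𝔸) L B₀ B₀β cB9 β len (torusIdx (d := d) (le_trans one_le_two hL) t).η m
        (torusIdx (d := d) (le_trans one_le_two hL) t).Ω (torusIdx (d := d) (le_trans one_le_two hL) t).Λs
        (torusIdx (d := d) (le_trans one_le_two hL) t).Λb) :
    ∃ B₁ B₂ c₁ : ℝ, 0 < B₁ ∧ 0 < B₂ ∧ 0 < c₁ ∧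
      ∀ t : TorusMember, ∀ α₀ α₁ : ℝ, 0 < α₀ → 0 < α₁ → α₀ + α₁ ≤ c₁ →
        ∀ U₀ U' : LSite d → Fin d → 𝔸ˣ, (∀ x κ, U₀ x κ ∈ unitaryUnits 𝔸) → (∀ x κ, U' x κ ∈ unitaryUnits 𝔸) →
          InAk L t.k t.η α₀ (fun _ => Set.univ) U₀ →
          InAk L t.k t.η α₀ (fun _ => Set.univ) (U' * U₀) → InAx L t.k (torusLam t.k) U₀ (U' * U₀) →
          Cond135T L t.k U₀ U' α₁ →
          ∃ u : LSite d → 𝔸ˣ, (∀ x, u x ∈ unitaryUnits 𝔸) ∧ Restr129 L t.k (torusLam t.k) U₀ u ∧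
            ∃ A : LSite d → Fin d → 𝔸,
              (∀ (x : LSite d) (μ : Fin d), IsSelfAdjoint (A x μ)) ∧
              mgauge U₀ u⁻¹ U' = cfgExp t.η A ∧
              (∀ j, j ≤ t.k → ∀ (x : LSite d) (μ : Fin d), ‖A x μ‖ ≤ B₁ * (α₀ + (11 * (d : ℝ) ^ 2 * α₀ + α₁)) * ((L : ℝ) ^ j * t.η)⁻¹) ∧
              C137T L t.k t.η α₁ U₀ A ∧
              IsLandau138 L t.k t.η (Set.univ : Set (LSite d)) (torusLam t.k) U₀ A ∧
              msup L t.k t.η (-(2 : ℝ)) (fun _ (q : Fin d × Fin d × LSite d) => SideTouches (Set.univ : Set (LSite d)) q.2.2 q.2.1)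
                  (fun q => covDerivFwd t.η U₀ q.1 (fun z => A z q.2.1) q.2.2) ≤ B₁ * (α₀ + (11 * (d : ℝ) ^ 2 * α₀ + α₁)) ∧
              msup L t.k t.η (-(2 + β)) (fun _ (q : Fin d × Fin d × (LSite d × LSite d)) => q.2.2 ∈ AdmPair t.η len ∧ q.2.2.1 ∈ (Set.univ : Set (LSite d)))
                  (fun q => hquot t.η β len U₀ (covDerivFwd t.η U₀ q.1 (fun z => A z q.2.1)) q.2.2) ≤ B₂ * (α₀ + (11 * (d : ℝ) ^ 2 * α₀ + α₁)) ∧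
              bondNorm L t.k t.η (-(3 : ℝ)) (fun _ => (Set.univ : Set (LSite d))) (fun x μ => pdiv t.η U₀ (plaqCovDeriv t.η U₀ A) μ x)
                  ≤ B₁ * (α₀ + (11 * (d : ℝ) ^ 2 * α₀ + α₁)) ∧
              bondNorm L t.k t.η (-(3 : ℝ)) (fun _ => (Set.univ : Set (LSite d))) (fun x μ => covLap t.η U₀ (fun z => A z μ) x)
                  ≤ B₁ * (α₀ + (11 * (d : ℝ) ^ 2 * α₀ + α₁)) := by
  have hL1 : 1 ≤ L := le_trans one_le_two hL
  obtain ⟨B₁, B₂, c₁, hB₁, hB₂, hc₁, H⟩ :=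
    thm2_torus_of_socketsE (𝔸 := 𝔸) (β := β) (len := len) hd2 hL hB₀ hB₀' hB₀β hB hcu hcF₀ hcF hcu' hcB9 SHFP₀ SHFP SP5u SB9all
  refine ⟨B₁, B₂, c₁, hB₁, hB₂, hc₁, ?_⟩
  intro t α₀ α₁ hα₀ hα₁ hs U₀ U' hU₀ hU' h33 h34 hAx h35
  obtain ⟨u, hR, ⟨h136, h137, hLan, h139⟩, -⟩ :=
    H t α₀ α₁ hα₀ hα₁ hs ⟨U₀, hU₀⟩ (⟨U₀, hU₀⟩, ⟨U', hU'⟩) h33 trivial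
      ⟨rfl, h34, inAx_torusLam_of_top hL1 hAx⟩ (h135_of_cond135T h35)
  -- the gauge-fixed field, read back on the concrete carrier, and its logarithm
  set W : LSite d → Fin d → 𝔸ˣ := mgauge U₀ u.1⁻¹ U' with hW
  have hR' : Restr129 L t.k (torusLam t.k) U₀ u.1 := hR
  have hLan' : IsLandau138 L t.k t.η (Set.univ : Set (LSite d)) (torusLam t.k) U₀ (logCfg t.η W) := hLan
  have h137' : ∀ j, j ≤ t.k → ∀ c ∈ torusLamb (d := d) t.k j,
      ‖logCovIter L U₀ (iEta t.η (mlogCfg t.k t.η (fun _ => (Set.univ : Set (LSite d))) W)) j c.1 c.2‖ < 2 * d * L * α₁ := h137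
  obtain ⟨h136a, h136g, h136h⟩ := h136
  obtain ⟨h139j, h139l⟩ := h139
  have h136a' : ∀ j, j ≤ t.k → ∀ b ∈ {b : LSite d × Fin d | SideTouches (Set.univ : Set (LSite d)) b.1 b.2},
      W b.1 b.2 = cfgExp t.η (logCfg t.η W) b.1 b.2 ∧ IsSelfAdjoint (logCfg t.η W b.1 b.2) ∧
        ‖logCfg t.η W b.1 b.2‖ ≤ B₁ * (α₀ + (11 * (d : ℝ) ^ 2 * α₀ + α₁)) * ((L : ℝ) ^ j * t.η)⁻¹ := h136a
  simp only [tI_eta, tI_k, tI_Ω] at h136g h136h h139j h139l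
  rw [mlogCfg_univ hd2] at h136g h136h h139j h139l h137'
  refine ⟨u.1, u.2.1, hR', logCfg t.η W, ?_, ?_, ?_, ?_, hLan', h136g, h136h, h139j, h139l⟩
  · intro x μ
    exact (h136a' 0 (Nat.zero_le _) (x, μ) (sideTouches_univ' hd2 x μ)).2.1
  · funext x μ
    exact (h136a' 0 (Nat.zero_le _) (x, μ) (sideTouches_univ' hd2 x μ)).1
  · intro j hj x μ
    exact (h136a' j hj (x, μ) (sideTouches_univ' hd2 x μ)).2.2
  · intro x ν
    exact h137' t.k le_rfl (x, ν) ((mem_torusLamb_iff t.k t.k (x, ν)).2 rfl)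

end Core

#print axioms thm2T_core_of_socketsE

end Literature.MathematicalPhysics.QuantumFieldTheory.Balaban1983to89.B8Thm2TorusBridge

end
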